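import Summits.FinalStateConjecture.FinalStateConjecture.Theses.BondiDrainDispersal
import Summits.FinalStateConjecture.FinalStateConjecture.Theorems.PhotonSphereChannelsChannelsResolveTameDevelopmentsRMinkowskiMaximal
import Summits.FinalStateConjecture.FinalStateConjecture.Theorems.ZeroEnergyKerrOrBombStationaryLimitReductionOneDevelopment
import Summits.FinalStateConjecture.FinalStateConjecture.Theorems.EIHFluxBalanceModulatedKerrHandoffStubRaysStayInClosureTransport
import Summits.FinalStateConjecture.FinalStateConjecture.Theorems.EIHFluxBalanceModulatedKerrHandoffStubRayTransport
import HarnessLib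

/-!
# `DrainImpliesDisperse` holds on the whole fibre over the trivial datum (small-model fact)

Refuter's anti-vacuity certificate for the crux `BondiDrainDispersal.DrainImpliesDisperse`
(item stmt-FinalStateConjecture-17283; verbatim `NoNullFinalMomentum.DrainImpliesDisperse`): its
CONCLUSION — the re-typed (T2) dispersive clause `∃ O d, d.N = 0 ∧ O = exteriorOf 𝒟 d.charted ∧
RaysStayInClosure 𝒟 O ∧ HasExhaustiveCharts d ∧ IsFutureOriented d`, with the number of holes PINNED to
`0` — is satisfiable in the crux's exact typing, and the crux restricted to `X = ℝ³`, `D = trivialData`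
is TRUE for every maximal vacuum Cauchy development, unconditionally (the hypotheses "complete `𝓘⁺`" and
"vanishing final Bondi mass" are idle there). Assembly of landed tree theorems only: a maximal
development of the trivial datum is isometric, as a development, to Minkowski space
(`Minkowski.isIsometricTo_vacuumCauchyDevelopment_of_isMaximal`, geodesic completeness ⇒ onto;
Choquet-Bruhat–Geroch 1969, Ringström 2009 Thm. 16.6); Minkowski space carries the honest `N = 0`
decomposition `minkowskiDecomp` of `{x⁰ ≥ 0} = exteriorOf` (`UniversalWitnessFamily.Negative`), whose
rays stay and whose identity flat chart is future-oriented (`ChannelsResolveTameDevelopmentsR.TrivialDatum`);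
everything is pushed forward along the isometry (`OneLockedExplosion.transportDecomposition`, which keeps
`N` by `rfl`; `EIHFluxBalance.TameTemplate.stub_raysStayInClosure_transport`). So a counterexample to the
crux needs a NON-FLAT admissible datum. No new definition, no `sorry`.
-/

noncomputable section

-- every `Summit.FinalStateConjecture.FinalStateConjecture.…` name repeats the summit = sub-problem segment (D-0017 layout)
set_option linter.dupNamespace false

open Set Filter Function TopologicalSpace
open scoped Manifold ContDiff Topology

namespace Summit.FinalStateConjecture.FinalStateConjecture.Theorems.DrainImpliesDisperse.Negative

open Literature.Geometry.Lorentzian Literature.Geometry.Lorentzian.Minkowski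
open Summit.FinalStateConjecture (HasCompleteNullInfinity exteriorOf RaysStayInClosure HasExhaustiveCharts
  IsFutureOriented)
open Summit.FinalStateConjecture.FinalStateConjecture.Theorems.OneLockedExplosion
  (transportDecomposition charted_transportDecomposition mdifferentiable_diffeomorph image_exteriorOf
    hasExhaustiveCharts_transportDecomposition)
open Summit.FinalStateConjecture.FinalStateConjecture.Theorems.UniversalWitnessFamily.Negative
  (minkowskiDecomp minkowskiExterior minkowskiExterior_eq_exteriorOf hasExhaustiveCharts_minkowskiDecomp)
open Summit.FinalStateConjecture.FinalStateConjecture.Theorems.ChannelsResolveTameDevelopmentsR.TrivialDatum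
  (raysStayInClosure_minkowski isFutureOriented_minkowskiDecomp)
open Summit.FinalStateConjecture.FinalStateConjecture.Theorems.EIHFluxBalance.TameTemplate
  (stub_raysStayInClosure_transport stub_rayTransport)

/-- **Future orientation of a final-state decomposition rides along a time-orientation preserving
isometric diffeomorphism `ψ : 𝓢₁ ≃ 𝓢₂`** (chain rule + O'Neill's timecone lemma,
`PreservesTimeOrientation.isFutureDirected_mfderiv`; the motions are kept, so they stay orthochronous).
[cite: ONeillSemiRiemannian1983, Ch. 5, p. 145] -/
theorem isFutureOriented_transportDecomposition_of_isIsometry {𝓢₁ 𝓢₂ : Spacetime.{0} 4}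
    (ψ : Diffeomorph (𝓡 4) (𝓡 4) 𝓢₁.carrier 𝓢₂.carrier ∞)
    (hiso : 𝓢₁.metric.IsIsometry 𝓢₂.metric.toPseudoRiemannianMetric ψ)
    (hτ : 𝓢₁.timeOrientation.PreservesTimeOrientation ψ 𝓢₂.timeOrientation)
    {O : Set 𝓢₁.carrier} {k : ℕ} (d : FinalStateDecomposition 𝓢₁ O k) (h : IsFutureOriented d) :
    IsFutureOriented (transportDecomposition ψ hiso hτ d) := by
  -- chain rule + timecone lemma for one chart `Ψ : U → 𝓢₁`
  have step : ∀ {U : Opens E4} {Ψ : U → 𝓢₁.carrier}, ContMDiff 𝓘(ℝ, E4) (𝓡 4) ∞ Ψ →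
      ∀ {x : U} {v : E4}, 𝓢₁.timeOrientation.IsFutureDirected (mfderiv 𝓘(ℝ, E4) (𝓡 4) Ψ x v) →
        𝓢₂.timeOrientation.IsFutureDirected (mfderiv 𝓘(ℝ, E4) (𝓡 4) (ψ ∘ Ψ) x v) := by
    intro U Ψ hΨ x v hv
    have hc : MDifferentiableAt 𝓘(ℝ, E4) (𝓡 4) Ψ x := (hΨ.mdifferentiable (by simp)) x
    rw [mfderiv_comp x (mdifferentiable_diffeomorph ψ _) hc]
    exact hτ.isFutureDirected_mfderiv hiso hv
  obtain ⟨h₁, h₂, h₃⟩ := h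
  refine ⟨h₁, fun i ρ ↦ (h₂ i ρ).mono fun τ hτ' x hx ↦ ?_, h₃.mono fun τ hτ' x hx ↦ ?_⟩
  · exact step (d.isLateChart i).contMDiff (hτ' x hx)
  · exact step d.isLateChart_flat.contMDiff (hτ' x hx)

/-- **Every maximal vacuum Cauchy development of the trivial datum `(ℝ³, δ, 0)` carries an honest
DISPERSIVE (`N = 0`) final-state decomposition in the re-typed (T2) sense** — the conclusion of the
crux `DrainImpliesDisperse` verbatim, number of holes pinned to `0`: push the identity decomposition
`minkowskiDecomp` of Minkowski space (`N := 0`) forward along the development isometry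
`ψ : ℝ⁴ ≃ 𝒟` (`Minkowski.isIsometricTo_vacuumCauchyDevelopment_of_isMaximal`); `ψ(O) = exteriorOf 𝒟
ψ(charted)` (`image_exteriorOf`), rays (`stub_raysStayInClosure_transport`), exhaustion
(`hasExhaustiveCharts_transportDecomposition`) and chart orientation ride along. Christodoulou–Klainerman
1993, Thm. 1.0.2 (Minkowski space is the `N = 0` final state). [cite: Ringstrom2009, Thm. 16.6] -/
theorem exists_dispersiveDecomposition_of_isMaximal (𝒟 : VacuumCauchyDevelopment trivialData)
    (hmax : 𝒟.IsMaximal) :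
    ∃ (O : Set 𝒟.carrier) (d : FinalStateDecomposition 𝒟.toSpacetime O 2), d.N = 0 ∧
      O = exteriorOf 𝒟.toCauchyDevelopment d.charted ∧ RaysStayInClosure 𝒟.toCauchyDevelopment O ∧
        HasExhaustiveCharts d ∧ IsFutureOriented d := by
  obtain ⟨ψ, hiso, hτ, hι⟩ := Minkowski.isIsometricTo_vacuumCauchyDevelopment_of_isMaximal hmax
  refine ⟨ψ '' minkowskiExterior, transportDecomposition (𝓢₁ := vacuumCauchyDevelopment.toSpacetime)
      (𝓢₂ := 𝒟.toSpacetime) ψ hiso hτ minkowskiDecomp, rfl, ?_, ?_,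
    hasExhaustiveCharts_transportDecomposition _ hiso hτ minkowskiDecomp hasExhaustiveCharts_minkowskiDecomp,
    isFutureOriented_transportDecomposition_of_isIsometry _ hiso hτ minkowskiDecomp
      isFutureOriented_minkowskiDecomp⟩
  · rw [charted_transportDecomposition, ← image_exteriorOf ψ hiso hτ hι]
    exact congrArg (fun S : Set vacuumCauchyDevelopment.carrier ↦ (ψ : _ → 𝒟.carrier) '' S)
      minkowskiExterior_eq_exteriorOf
  · exact stub_raysStayInClosure_transport _ trivialData vacuumCauchyDevelopment 𝒟 ψ hiso hτ hι
      (fun p γ dom ↦ stub_rayTransport _ trivialData vacuumCauchyDevelopment 𝒟 ψ hiso hτ hι p γ dom)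
      minkowskiExterior raysStayInClosure_minkowski

/-- **The crux `DrainImpliesDisperse` HOLDS ON THE FIBRE OVER THE TRIVIAL DATUM** (`X = ℝ³ = slice`,
`D = trivialData`, every MGHD), unconditionally: the body of
`Theses.BondiDrainDispersal.DrainImpliesDisperse` at that datum, with its hypotheses complete `𝓘⁺` and
vanishing final Bondi mass idle. Small-model fact for the refuter's vetting (the conclusion block with
`d.N = 0` pinned is kernel-checked satisfiable; a counterexample needs a non-flat admissible datum); it
does not close the item. [cite: ChristodoulouKlainerman1993, Thm. 1.0.2] -/
theorem drainImpliesDisperse_trivialDatumFibre :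
    ∀ 𝒟 : VacuumCauchyDevelopment trivialData, 𝒟.IsMaximal →
      HasCompleteNullInfinity 𝒟.toCauchyDevelopment → 𝒟.toCauchyDevelopment.HasVanishingFinalBondiMass →
        ∃ (O : Set 𝒟.carrier) (d : FinalStateDecomposition 𝒟.toSpacetime O 2), d.N = 0 ∧
          O = exteriorOf 𝒟.toCauchyDevelopment d.charted ∧ RaysStayInClosure 𝒟.toCauchyDevelopment O ∧
            HasExhaustiveCharts d ∧ IsFutureOriented d :=
  fun 𝒟 hmax _ _ ↦ exists_dispersiveDecomposition_of_isMaximal 𝒟 hmax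

/-- **Logical form**: the universally quantified crux, specialised to the trivial datum, is exactly the
fibre statement above — so `DrainImpliesDisperse` implies nothing new there and is consistent with it
(sanity: the specialisation type-checks against the route decl by name). [folklore] -/
theorem drainImpliesDisperse_specialises
    (h : Summit.FinalStateConjecture.FinalStateConjecture.Theses.BondiDrainDispersal.DrainImpliesDisperse) :
    ∀ 𝒟 : VacuumCauchyDevelopment trivialData, 𝒟.IsMaximal →
      HasCompleteNullInfinity 𝒟.toCauchyDevelopment → 𝒟.toCauchyDevelopment.HasVanishingFinalBondiMass →
        ∃ (O : Set 𝒟.carrier) (d : FinalStateDecomposition 𝒟.toSpacetime O 2), d.N = 0 ∧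
          O = exteriorOf 𝒟.toCauchyDevelopment d.charted ∧ RaysStayInClosure 𝒟.toCauchyDevelopment O ∧
            HasExhaustiveCharts d ∧ IsFutureOriented d :=
  h slice trivialData trivialData_mem_admissibleVacuumData

end Summit.FinalStateConjecture.FinalStateConjecture.Theorems.DrainImpliesDisperse.Negative

end
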